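import Mathlib.MeasureTheory.Measure.Lebesgue.EqHaar
import Literature.Geometry.Lorentzian.WeightedNorms
import Literature.Geometry.Lorentzian.LateChartDilation
import HarnessLib

/-!
# Crux `PhaseMixingCapture.BulkKerrCaptureC2` (stmt-FinalStateConjecture-14985): the weighted Sobolev seminorms
# under the dilation `y ↦ l y` of `ℝ³` (analysis half of the data side of the mass normalisation `M ↦ 1`)

Support file for the crux `BulkKerrCaptureC2`.  The data ball of its matrix `CaptureC2At s δ M _ ε η a` is an
`H^s_δ × H^{s-1}_{δ+1}`-ball (`InitialDataSet.dataWeightedSobolevEDist`, Bartnik's weights `(1 + ‖x‖)^{δ+m}` on the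
`m`-th Cartesian derivative, `WeightedNorms.lean`) about `Kerr.data M a M` in the FIXED Kerr–Schild chart of the
slice `Kerr.slice a M ⊆ ℝ³`.  Reducing the crux to unit mass rescales the chart by `y ↦ l y`; this file proves that
the weighted Sobolev seminorms are equivalent under that change of variables, with a constant depending only on
`(l, s, δ)`:

* `one_add_norm_rpow_le_mul` — the weights are comparable: `(1 + ‖y‖)^p ≤ W(l, p) (1 + ‖l y‖)^p` for EVERY real
  `p` (`W = max ((max 1 l⁻¹)^p) ((min 1 l⁻¹)^p)`, the ratio `(1 + t)/(1 + lt)` lying in `[min 1 l⁻¹, max 1 l⁻¹]`);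
* `lintegral_comp_smul_indicator` — the change of variables `z = l y` in a Lebesgue integral over `ℝ³`
  (`Measure.map_addHaar_smul`: `∫ G(l y) dy = l⁻³ ∫ G`), for indicator-restricted integrands (no measurability);
* `norm_iteratedFDeriv_const_smul_le` — `‖Dᵐ(c • f)(x)‖ ≤ |c| ‖Dᵐ f(x)‖` with NO differentiability hypothesis
  (`ContinuousLinearEquiv.iteratedFDeriv_comp_left` for the scalar equivalence `c • id`, `c ≠ 0`);
* `weightedSobolevSeminorm_comp_smul_le` — **`‖f ∘ (l ·)‖_{H^s_δ(U)} ≤ K ‖f‖_{H^s_δ(V)}`** whenever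
  `y ∈ U ↔ l y ∈ V` (`V` measurable), with `K = K(l, s, δ)` (`‖Dᵐ(f ∘ (l ·))(y)‖ ≤ lᵐ ‖Dᵐf (ly)‖`,
  `norm_iteratedFDeriv_comp_smul_le` of `LateChartDilation.lean`, the weight comparison and the change of
  variables, summed over `m ≤ s` and square-rooted);
* `weightedSobolevSeminorm_const_smul_le` — `‖c • f‖_{H^s_δ(U)} ≤ |c| ‖f‖_{H^s_δ(U)}`.

Everything is proved; no definitions, no named facts.  References: R. Bartnik, CPAM 39 (1986), (1.2)–(1.3) (the
weighted classes and their scaling); D. Christodoulou, S. Klainerman (1993), (1.0.9).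
-/

-- the doubled `FinalStateConjecture.FinalStateConjecture` path component trips dupNamespace
set_option linter.dupNamespace false

noncomputable section

open Set Function MeasureTheory
open scoped ENNReal Topology
open Literature.Geometry.Lorentzian

namespace Summit.FinalStateConjecture.FinalStateConjecture.Theorems.BulkKerrCaptureC2.Scaling

/-! ## §1 The weights `(1 + ‖x‖)^p` under `x ↦ l x` -/

/-- **The Bartnik weights are comparable under dilation, for every real exponent**:
`(1 + ‖y‖)^p ≤ W · (1 + ‖l y‖)^p` with `W = max ((max 1 l⁻¹)^p) ((min 1 l⁻¹)^p)` (`l > 0`): the ratio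
`r = (1 + ‖y‖)/(1 + l‖y‖)` lies in `[min 1 l⁻¹, max 1 l⁻¹]`, and `r ↦ r^p` is monotone for `p ≥ 0`, antitone
for `p ≤ 0`. Bartnik 1986, (1.2) (the weight `σ = (1 + |x|²)^{1/2} ≍ 1 + |x|`). [cite: Bartnik1986, (1.2)] -/
theorem one_add_norm_rpow_le_mul {F : Type*} [NormedAddCommGroup F] [NormedSpace ℝ F] {l : ℝ} (hl : 0 < l)
    (p : ℝ) (y : F) :
    (1 + ‖y‖) ^ p ≤ max ((max 1 l⁻¹) ^ p) ((min 1 l⁻¹) ^ p) * (1 + ‖l • y‖) ^ p := by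
  have ht : 0 ≤ ‖y‖ := norm_nonneg y
  have hly : ‖l • y‖ = l * ‖y‖ := by rw [norm_smul, Real.norm_of_nonneg hl.le]
  rw [hly]
  have h1 : 0 < 1 + ‖y‖ := by positivity
  have h2 : 0 < 1 + l * ‖y‖ := by positivity
  set r : ℝ := (1 + ‖y‖) / (1 + l * ‖y‖) with hr
  have hr0 : 0 < r := div_pos h1 h2
  have hfac : 1 + ‖y‖ = r * (1 + l * ‖y‖) := by rw [hr, div_mul_cancel₀ _ h2.ne']
  have hup : r ≤ max 1 l⁻¹ := by
    rw [hr, div_le_iff₀ h2]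
    rcases le_or_gt 1 l with hl1 | hl1
    · calc 1 + ‖y‖ ≤ 1 + l * ‖y‖ := by nlinarith
        _ ≤ max 1 l⁻¹ * (1 + l * ‖y‖) := le_mul_of_one_le_left h2.le (le_max_left _ _)
    · have hli : l⁻¹ * (1 + l * ‖y‖) = l⁻¹ + ‖y‖ := by field_simp
      have hli1 : 1 ≤ l⁻¹ := (one_le_inv₀ hl).2 hl1.le
      calc 1 + ‖y‖ ≤ l⁻¹ + ‖y‖ := by linarith
        _ = l⁻¹ * (1 + l * ‖y‖) := hli.symm
        _ ≤ max 1 l⁻¹ * (1 + l * ‖y‖) := mul_le_mul_of_nonneg_right (le_max_right _ _) h2.le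
  have hlow : min 1 l⁻¹ ≤ r := by
    rw [hr, le_div_iff₀ h2]
    rcases le_or_gt l 1 with hl1 | hl1
    · calc min 1 l⁻¹ * (1 + l * ‖y‖) ≤ 1 * (1 + l * ‖y‖) :=
            mul_le_mul_of_nonneg_right (min_le_left _ _) h2.le
        _ ≤ 1 + ‖y‖ := by nlinarith
    · have hli : l⁻¹ * (1 + l * ‖y‖) = l⁻¹ + ‖y‖ := by field_simp
      have hli1 : l⁻¹ ≤ 1 := inv_le_one_of_one_le₀ hl1.le
      calc min 1 l⁻¹ * (1 + l * ‖y‖) ≤ l⁻¹ * (1 + l * ‖y‖) :=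
            mul_le_mul_of_nonneg_right (min_le_right _ _) h2.le
        _ = l⁻¹ + ‖y‖ := hli
        _ ≤ 1 + ‖y‖ := by linarith
  rw [hfac, Real.mul_rpow hr0.le h2.le]
  refine mul_le_mul_of_nonneg_right ?_ (Real.rpow_nonneg h2.le _)
  rcases le_or_gt 0 p with hp | hp
  · exact (Real.rpow_le_rpow hr0.le hup hp).trans (le_max_left _ _)
  · exact (Real.rpow_le_rpow_of_nonpos (lt_min one_pos (inv_pos.2 hl)) hlow hp.le).trans (le_max_right _ _)

/-- The comparison constant of `one_add_norm_rpow_le_mul` is positive. [folklore] -/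
theorem weightConst_pos {l : ℝ} (hl : 0 < l) (p : ℝ) : 0 < max ((max 1 l⁻¹) ^ p) ((min 1 l⁻¹) ^ p) :=
  lt_max_of_lt_right (Real.rpow_pos_of_pos (lt_min one_pos (inv_pos.2 hl)) _)

/-! ## §2 The change of variables `z = l y` in Lebesgue integrals over `ℝ³` -/

/-- **Change of variables `z = l y` in a Lebesgue integral over `ℝ³`, indicator form**: if `y ∈ U ↔ l y ∈ V` then
`∫_U G(l y) dy = l⁻³ ∫_V G` for every `G : ℝ³ → [0, ∞]` (no measurability: the dilation is a measurable
equivalence, `lintegral_map_equiv`, and Lebesgue measure scales by `|l³|⁻¹`, `Measure.map_addHaar_smul`).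
[folklore] -/
theorem lintegral_comp_smul_indicator {l : ℝ} (hl : 0 < l) {U V : Set E3} (hV : MeasurableSet V)
    (hUV : ∀ y, y ∈ U ↔ l • y ∈ V) (G : E3 → ℝ≥0∞) :
    ∫⁻ y in U, G (l • y) = ENNReal.ofReal (l ^ 3)⁻¹ * ∫⁻ z in V, G z := by
  have hl0 : l ≠ 0 := hl.ne'
  have hU : U = (fun y : E3 ↦ l • y) ⁻¹' V := Set.ext fun y ↦ hUV y
  have hUm : MeasurableSet U := by
    rw [hU]
    exact (measurable_const_smul l) hV
  rw [← lintegral_indicator hUm, ← lintegral_indicator hV]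
  have hind : (fun y ↦ U.indicator (fun y ↦ G (l • y)) y) = fun y ↦ V.indicator G (l • y) := by
    funext y
    by_cases hy : y ∈ U
    · rw [Set.indicator_of_mem hy, Set.indicator_of_mem ((hUV y).1 hy)]
    · rw [Set.indicator_of_notMem hy, Set.indicator_of_notMem (fun h ↦ hy ((hUV y).2 h))]
  rw [hind]
  have hmap : Measure.map (fun y : E3 ↦ l • y) volume = ENNReal.ofReal |(l ^ 3)⁻¹| • (volume : Measure E3) := by
    have h := Measure.map_addHaar_smul (volume : Measure E3) hl0
    rwa [finrank_euclideanSpace_fin] at h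
  have he : ⇑(Homeomorph.smulOfNeZero l hl0).toMeasurableEquiv = fun y : E3 ↦ l • y := rfl
  calc ∫⁻ y, V.indicator G (l • y)
      = ∫⁻ y, V.indicator G ((Homeomorph.smulOfNeZero l hl0).toMeasurableEquiv y) := rfl
    _ = ∫⁻ z, V.indicator G z ∂(Measure.map (Homeomorph.smulOfNeZero l hl0).toMeasurableEquiv volume) :=
        (lintegral_map_equiv _ _).symm
    _ = ENNReal.ofReal (l ^ 3)⁻¹ * ∫⁻ z, V.indicator G z := by
        rw [he, hmap, lintegral_smul_measure, abs_of_pos (inv_pos.2 (pow_pos hl 3)), smul_eq_mul]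

/-! ## §3 Iterated derivatives of `c • f` without differentiability -/

/-- **`‖Dᵐ(c • f)(x)‖ ≤ |c| ‖Dᵐ f(x)‖` for `c ≠ 0`, with NO differentiability hypothesis** (junk values
included): `c • f = L ∘ f` for the continuous linear EQUIVALENCE `L = c • id`, and iterated derivatives commute
with linear equivalences on the left unconditionally (`ContinuousLinearEquiv.iteratedFDeriv_comp_left`).
[folklore] -/
theorem norm_iteratedFDeriv_const_smul_le {F G : Type*} [NormedAddCommGroup F] [NormedSpace ℝ F]
    [NormedAddCommGroup G] [NormedSpace ℝ G] (f : F → G) {c : ℝ} (hc : c ≠ 0) (m : ℕ) (x : F) :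
    ‖iteratedFDeriv ℝ m (c • f) x‖ ≤ |c| * ‖iteratedFDeriv ℝ m f x‖ := by
  let L : G ≃L[ℝ] G := ContinuousLinearEquiv.equivOfInverse (c • ContinuousLinearMap.id ℝ G)
    (c⁻¹ • ContinuousLinearMap.id ℝ G)
    (fun v ↦ by simp [smul_smul, mul_inv_cancel₀ hc])
    (fun v ↦ by simp [smul_smul, inv_mul_cancel₀ hc])
  have hL : (c • f) = (L : G → G) ∘ f := by
    funext y
    simp [L]
  rw [hL, L.iteratedFDeriv_comp_left]
  refine (ContinuousLinearMap.norm_compContinuousMultilinearMap_le _ _).trans ?_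
  refine mul_le_mul_of_nonneg_right ?_ (norm_nonneg _)
  change ‖c • ContinuousLinearMap.id ℝ G‖ ≤ |c|
  rw [norm_smul, Real.norm_eq_abs]
  exact mul_le_of_le_one_right (abs_nonneg c) ContinuousLinearMap.norm_id_le

/-! ## §4 The weighted Sobolev seminorms under `y ↦ l y` and under `f ↦ c • f` -/

section Sobolev

variable {G : Type*} [NormedAddCommGroup G] [NormedSpace ℝ G]

/-- One summand of the seminorm, pointwise: the dilated integrand is dominated by the original one at the
dilated point, `(1+‖y‖)^p ‖Dᵐ(f∘(l·))(y)‖² ≤ W l^{2m} · (1+‖ly‖)^p ‖Dᵐf(ly)‖²`. [folklore] -/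
theorem integrand_comp_smul_le {l : ℝ} (hl : 0 < l) (p : ℝ) (m : ℕ) (f : E3 → G) (y : E3) :
    (1 + ‖y‖) ^ p * ‖iteratedFDeriv ℝ m (fun z ↦ f (l • z)) y‖ ^ 2 ≤
      (max ((max 1 l⁻¹) ^ p) ((min 1 l⁻¹) ^ p) * l ^ (2 * m)) *
        ((1 + ‖l • y‖) ^ p * ‖iteratedFDeriv ℝ m f (l • y)‖ ^ 2) := by
  have h1 := one_add_norm_rpow_le_mul hl p y
  have h2 : ‖iteratedFDeriv ℝ m (fun z ↦ f (l • z)) y‖ ≤ l ^ m * ‖iteratedFDeriv ℝ m f (l • y)‖ := by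
    have := norm_iteratedFDeriv_comp_smul_le f hl.ne' m y
    rwa [abs_of_pos hl] at this
  have h3 : ‖iteratedFDeriv ℝ m (fun z ↦ f (l • z)) y‖ ^ 2 ≤ l ^ (2 * m) * ‖iteratedFDeriv ℝ m f (l • y)‖ ^ 2 := by
    have := pow_le_pow_left₀ (norm_nonneg _) h2 2
    rwa [mul_pow, ← pow_mul, mul_comm m 2] at this
  have hw : 0 ≤ (1 + ‖l • y‖) ^ p := Real.rpow_nonneg (by positivity) _
  calc (1 + ‖y‖) ^ p * ‖iteratedFDeriv ℝ m (fun z ↦ f (l • z)) y‖ ^ 2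
      ≤ (max ((max 1 l⁻¹) ^ p) ((min 1 l⁻¹) ^ p) * (1 + ‖l • y‖) ^ p) *
          (l ^ (2 * m) * ‖iteratedFDeriv ℝ m f (l • y)‖ ^ 2) :=
        mul_le_mul h1 h3 (sq_nonneg _) (mul_nonneg (weightConst_pos hl p).le hw)
    _ = _ := by ring

/-- One summand of the seminorm, integrated: `∫_U (1+‖y‖)^p ‖Dᵐ(f∘(l·))‖² ≤ W l^{2m} l⁻³ ∫_V (1+‖z‖)^p ‖Dᵐf‖²`
(`integrand_comp_smul_le` and the change of variables `lintegral_comp_smul_indicator`). [folklore] -/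
theorem lintegral_term_comp_smul_le {l : ℝ} (hl : 0 < l) {U V : Set E3} (hV : MeasurableSet V)
    (hUV : ∀ y, y ∈ U ↔ l • y ∈ V) (p : ℝ) (m : ℕ) (f : E3 → G) :
    ∫⁻ y in U, ENNReal.ofReal ((1 + ‖y‖) ^ p * ‖iteratedFDeriv ℝ m (fun z ↦ f (l • z)) y‖ ^ 2) ≤
      ENNReal.ofReal (max ((max 1 l⁻¹) ^ p) ((min 1 l⁻¹) ^ p) * l ^ (2 * m) * (l ^ 3)⁻¹) *
        ∫⁻ z in V, ENNReal.ofReal ((1 + ‖z‖) ^ p * ‖iteratedFDeriv ℝ m f z‖ ^ 2) := by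
  set C : ℝ := max ((max 1 l⁻¹) ^ p) ((min 1 l⁻¹) ^ p) * l ^ (2 * m) with hC
  have hC0 : 0 ≤ C := mul_nonneg (weightConst_pos hl p).le (pow_nonneg hl.le _)
  calc ∫⁻ y in U, ENNReal.ofReal ((1 + ‖y‖) ^ p * ‖iteratedFDeriv ℝ m (fun z ↦ f (l • z)) y‖ ^ 2)
      ≤ ∫⁻ y in U, ENNReal.ofReal C *
          ENNReal.ofReal ((1 + ‖l • y‖) ^ p * ‖iteratedFDeriv ℝ m f (l • y)‖ ^ 2) := by
        refine lintegral_mono fun y ↦ ?_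
        rw [← ENNReal.ofReal_mul hC0]
        exact ENNReal.ofReal_le_ofReal (integrand_comp_smul_le hl p m f y)
    _ = ENNReal.ofReal C * ∫⁻ y in U,
          ENNReal.ofReal ((1 + ‖l • y‖) ^ p * ‖iteratedFDeriv ℝ m f (l • y)‖ ^ 2) :=
        lintegral_const_mul' _ _ ENNReal.ofReal_ne_top
    _ = ENNReal.ofReal C * (ENNReal.ofReal (l ^ 3)⁻¹ *
          ∫⁻ z in V, ENNReal.ofReal ((1 + ‖z‖) ^ p * ‖iteratedFDeriv ℝ m f z‖ ^ 2)) := by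
        rw [lintegral_comp_smul_indicator hl hV hUV
          (fun z ↦ ENNReal.ofReal ((1 + ‖z‖) ^ p * ‖iteratedFDeriv ℝ m f z‖ ^ 2))]
    _ = _ := by
        rw [← mul_assoc, ← ENNReal.ofReal_mul hC0]

/-- **The weighted Sobolev seminorm under the dilation `y ↦ l y` of `ℝ³`.**  For `l > 0`, `s`, `δ` there is a
constant `K = K(l, s, δ) > 0` such that for all sets `U, V ⊆ ℝ³` with `y ∈ U ↔ l y ∈ V` (`V` measurable) and EVERY
`f : ℝ³ → G`, `‖f ∘ (l ·)‖_{H^s_δ(U)} ≤ K ‖f‖_{H^s_δ(V)}` (`weightedSobolevSeminorm`; junk values of `iteratedFDeriv`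
included, no smoothness needed): sum `lintegral_term_comp_smul_le` over `m ≤ s` with the constant
`B = ∑_{m ≤ s} W(2(δ+m)) l^{2m} l⁻³` dominating each summand's constant, and take square roots. Bartnik 1986,
(1.2)–(1.3), Thm. 1.2 (scaling of the weighted classes). [cite: Bartnik1986, (1.2)] -/
theorem weightedSobolevSeminorm_comp_smul_le {l : ℝ} (hl : 0 < l) (s : ℕ) (δ : ℝ) :
    ∃ K : ℝ, 0 < K ∧ ∀ (U V : Set E3), MeasurableSet V → (∀ y, y ∈ U ↔ l • y ∈ V) → ∀ f : E3 → G,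
      weightedSobolevSeminorm U s δ (fun y ↦ f (l • y)) ≤
        ENNReal.ofReal K * weightedSobolevSeminorm V s δ f := by
  -- the constants of the summands and their sum
  set Bm : ℕ → ℝ := fun m ↦ max ((max 1 l⁻¹) ^ (2 * (δ + m) : ℝ)) ((min 1 l⁻¹) ^ (2 * (δ + m) : ℝ)) *
    l ^ (2 * m) * (l ^ 3)⁻¹ with hBm
  have hBm0 : ∀ m, 0 < Bm m := fun m ↦
    mul_pos (mul_pos (weightConst_pos hl _) (pow_pos hl _)) (inv_pos.2 (pow_pos hl 3))
  set B : ℝ := ∑ m ∈ Finset.range (s + 1), Bm m with hB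
  have hB0 : 0 < B := Finset.sum_pos (fun m _ ↦ hBm0 m) ⟨0, by simp⟩
  have hBle : ∀ m ∈ Finset.range (s + 1), Bm m ≤ B := fun m hm ↦
    Finset.single_le_sum (fun m' _ ↦ (hBm0 m').le) hm
  refine ⟨Real.sqrt B, Real.sqrt_pos.2 hB0, fun U V hV hUV f ↦ ?_⟩
  unfold weightedSobolevSeminorm
  have hsum : ∑ m ∈ Finset.range (s + 1), ∫⁻ y in U,
        ENNReal.ofReal ((1 + ‖y‖) ^ (2 * (δ + m) : ℝ) * ‖iteratedFDeriv ℝ m (fun z ↦ f (l • z)) y‖ ^ 2) ≤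
      ENNReal.ofReal B * ∑ m ∈ Finset.range (s + 1), ∫⁻ z in V,
        ENNReal.ofReal ((1 + ‖z‖) ^ (2 * (δ + m) : ℝ) * ‖iteratedFDeriv ℝ m f z‖ ^ 2) := by
    rw [Finset.mul_sum]
    refine Finset.sum_le_sum fun m hm ↦ ?_
    refine (lintegral_term_comp_smul_le hl hV hUV _ m f).trans ?_
    exact mul_le_mul' (ENNReal.ofReal_le_ofReal (hBle m hm)) le_rfl
  calc (∑ m ∈ Finset.range (s + 1), ∫⁻ y in U, ENNReal.ofReal ((1 + ‖y‖) ^ (2 * (δ + m) : ℝ) *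
          ‖iteratedFDeriv ℝ m (fun z ↦ f (l • z)) y‖ ^ 2)) ^ (1 / 2 : ℝ)
      ≤ (ENNReal.ofReal B * ∑ m ∈ Finset.range (s + 1), ∫⁻ z in V,
          ENNReal.ofReal ((1 + ‖z‖) ^ (2 * (δ + m) : ℝ) * ‖iteratedFDeriv ℝ m f z‖ ^ 2)) ^ (1 / 2 : ℝ) :=
        ENNReal.rpow_le_rpow hsum (by norm_num)
    _ = _ := by
        rw [ENNReal.mul_rpow_of_nonneg _ _ (by norm_num : (0 : ℝ) ≤ 1 / 2),
          ENNReal.ofReal_rpow_of_nonneg hB0.le (by norm_num), ← Real.sqrt_eq_rpow]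

/-- **The weighted Sobolev seminorm of a constant multiple**: `‖c • f‖_{H^s_δ(U)} ≤ |c| ‖f‖_{H^s_δ(U)}` for
`c ≠ 0` (pointwise `norm_iteratedFDeriv_const_smul_le`, then sum and square root). Bartnik 1986, (1.2).
[cite: Bartnik1986, (1.2)] -/
theorem weightedSobolevSeminorm_const_smul_le (U : Set E3) (s : ℕ) (δ : ℝ) (f : E3 → G) {c : ℝ}
    (hc : c ≠ 0) :
    weightedSobolevSeminorm U s δ (c • f) ≤ ENNReal.ofReal |c| * weightedSobolevSeminorm U s δ f := by
  unfold weightedSobolevSeminorm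
  have hc2 : 0 ≤ c ^ 2 := sq_nonneg c
  have hpt : ∀ (p : ℝ) (m : ℕ) (x : E3),
      (1 + ‖x‖) ^ p * ‖iteratedFDeriv ℝ m (c • f) x‖ ^ 2 ≤
        c ^ 2 * ((1 + ‖x‖) ^ p * ‖iteratedFDeriv ℝ m f x‖ ^ 2) := by
    intro p m x
    have hw : 0 ≤ (1 + ‖x‖) ^ p := Real.rpow_nonneg (by positivity) _
    have h1 := norm_iteratedFDeriv_const_smul_le f hc m x
    have h2 : ‖iteratedFDeriv ℝ m (c • f) x‖ ^ 2 ≤ c ^ 2 * ‖iteratedFDeriv ℝ m f x‖ ^ 2 := by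
      have := pow_le_pow_left₀ (norm_nonneg _) h1 2
      rwa [mul_pow, sq_abs] at this
    calc (1 + ‖x‖) ^ p * ‖iteratedFDeriv ℝ m (c • f) x‖ ^ 2
        ≤ (1 + ‖x‖) ^ p * (c ^ 2 * ‖iteratedFDeriv ℝ m f x‖ ^ 2) := mul_le_mul_of_nonneg_left h2 hw
      _ = _ := by ring
  have hsum : ∑ m ∈ Finset.range (s + 1), ∫⁻ x in U,
        ENNReal.ofReal ((1 + ‖x‖) ^ (2 * (δ + m) : ℝ) * ‖iteratedFDeriv ℝ m (c • f) x‖ ^ 2) ≤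
      ENNReal.ofReal (c ^ 2) * ∑ m ∈ Finset.range (s + 1), ∫⁻ x in U,
        ENNReal.ofReal ((1 + ‖x‖) ^ (2 * (δ + m) : ℝ) * ‖iteratedFDeriv ℝ m f x‖ ^ 2) := by
    rw [Finset.mul_sum]
    refine Finset.sum_le_sum fun m _ ↦ ?_
    rw [← lintegral_const_mul' _ _ ENNReal.ofReal_ne_top]
    refine lintegral_mono fun x ↦ ?_
    rw [← ENNReal.ofReal_mul hc2]
    exact ENNReal.ofReal_le_ofReal (hpt _ m x)
  calc (∑ m ∈ Finset.range (s + 1), ∫⁻ x in U, ENNReal.ofReal ((1 + ‖x‖) ^ (2 * (δ + m) : ℝ) *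
          ‖iteratedFDeriv ℝ m (c • f) x‖ ^ 2)) ^ (1 / 2 : ℝ)
      ≤ (ENNReal.ofReal (c ^ 2) * ∑ m ∈ Finset.range (s + 1), ∫⁻ x in U,
          ENNReal.ofReal ((1 + ‖x‖) ^ (2 * (δ + m) : ℝ) * ‖iteratedFDeriv ℝ m f x‖ ^ 2)) ^ (1 / 2 : ℝ) :=
        ENNReal.rpow_le_rpow hsum (by norm_num)
    _ = _ := by
        rw [ENNReal.mul_rpow_of_nonneg _ _ (by norm_num : (0 : ℝ) ≤ 1 / 2),
          ENNReal.ofReal_rpow_of_nonneg hc2 (by norm_num), ← Real.sqrt_eq_rpow, Real.sqrt_sq_eq_abs]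

end Sobolev

/-- **Registered sub-goal `stub_weightedSobolevSeminorm_comp_smul_le`** (crux item stmt-FinalStateConjecture-14985):
the weighted Sobolev seminorms of bilinear-form-valued component functions on `ℝ³` (the values of
`InitialDataSet.hFun`/`kFun`) are controlled under the dilation `y ↦ l y` by a constant depending only on
`(l, s, δ)` (closed form of `weightedSobolevSeminorm_comp_smul_le`). [cite: Bartnik1986, (1.2)] -/
theorem stub_weightedSobolevSeminorm_comp_smul_le : ∀ (l : ℝ), 0 < l → ∀ (s : ℕ) (δ : ℝ), ∃ K : ℝ, 0 < K ∧ ∀ (U V : Set E3), MeasurableSet V → (∀ y, y ∈ U ↔ l • y ∈ V) → ∀ f : E3 → (E3 →L[ℝ] E3 →L[ℝ] ℝ), weightedSobolevSeminorm U s δ (fun y ↦ f (l • y)) ≤ ENNReal.ofReal K * weightedSobolevSeminorm V s δ f :=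
  fun _ hl s δ ↦ weightedSobolevSeminorm_comp_smul_le hl s δ

end Summit.FinalStateConjecture.FinalStateConjecture.Theorems.BulkKerrCaptureC2.Scaling

end
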